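import Mathlib
import Summits.ValiantsHypothesis.ValiantsHypothesis.Theorems.ValuativeGCTValuativeFlipTridiagonalAdjugate

/-!
# Cofactors of the tridiagonal Toeplitz pencil span all ternary forms

Crux `ValuativeGCT.ValuativeFlip` (stmt-ValiantsHypothesis-12624), wall-breaker axis 14
("plethysm tables, small cases certified"), gen 1: row 3 of the few-row table
(ternary forms are border-determinantal), file 3 of 5 (over `…TridiagonalAdjugate`).

With `adj(T)_{ij} = (-y)^{j-i} θ_i θ_{n-j}` (`i ≤ j`) and the triangularity of the products
`θ_p θ_q` (`tco_X_pow_mul_w_pow_mem`): every monomial `x^a y^b z^c` of degree `n` is a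
`ℂ`-combination of cofactors of `T = triT n` (`monomial_mem_cofSpan`: for `b ≥ c` write it as
`y^{b-c} x^a (yz)^c` and use the cofactors `(i, i + b - c)`; symmetrically below the diagonal), hence
every ternary form of degree `n + 1` lies in `tanSpan n = span_ℂ {X_t · adj(T)_{ij}}`
(`homogeneousSubmodule_le_tanSpan`, registered stub).  Since
`d/dε det(T + ε X_t E_{ij}) = X_t adj(T)_{ji}`, this says that the differential of
`(A₀, A₁, A₂) ↦ det(x A₀ + y A₁ + z A₂)` at the tridiagonal Toeplitz pencil is SURJECTIVE onto
ternary forms of degree `n + 1` (numerically: rank `C(n+3, 2)`, checked for `n + 1 ≤ 9`); the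
next files turn this into "every ternary form is border-determinantal".

References: classical; this crux (k14 gen1).
-/

set_option linter.dupNamespace false

namespace Summit.ValiantsHypothesis.ValiantsHypothesis.Theorems.ValuativeFlip

open MvPolynomial
open scoped BigOperators Matrix

noncomputable section

/-! ## The cofactors span all ternary forms of degree `n` -/

/-- The `ℂ`-span of the cofactors of `T`. [this file] -/
def cofSpan (n : ℕ) : Submodule ℂ (MvPolynomial (Fin 3) ℂ) :=
  Submodule.span ℂ (Set.range fun ij : Fin (n + 1) × Fin (n + 1) => (triT n).adjugate ij.1 ij.2)

/-- **Cofactor span.** Every monomial `x^a y^b z^c` of degree `n` is a `ℂ`-combination of the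
cofactors of the tridiagonal Toeplitz pencil of size `n + 1`: for `b ≥ c`,
`x^a y^b z^c = y^{b-c} · x^a w^c`, `x^a w^c ∈ span{θ_p θ_q : p + q = a + 2c}` (triangularity) and
`y^{b-c} θ_p θ_q = ± adj(T)_{p, p+b-c}`; symmetrically with `z` below the diagonal. [this crux] -/
theorem monomial_mem_cofSpan {n a b c : ℕ} (h : a + b + c = n) :
    (X 0 ^ a * X 1 ^ b * X 2 ^ c : MvPolynomial (Fin 3) ℂ) ∈ cofSpan n := by
  rcases le_or_gt c b with hcb | hbc
  · obtain ⟨d, rfl⟩ : ∃ d, b = c + d := ⟨b - c, by omega⟩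
    have hS := tco_X_pow_mul_w_pow_mem a c
    have hmul : (X 1 ^ d * (X 0 ^ a * (X 1 * X 2) ^ c) : MvPolynomial (Fin 3) ℂ) ∈ cofSpan n := by
      refine mul_mem_span_of_forall_mul_mem hS fun s hs => ?_
      obtain ⟨p, q, hpq, rfl⟩ := hs
      have hp : p < n + 1 := by omega
      have hpd : p + d < n + 1 := by omega
      have hgen : (triT n).adjugate ⟨p, hp⟩ ⟨p + d, hpd⟩ = (-X 1) ^ d * tco p * tco q := by
        rw [adjugate_triT_apply, Fin.val_mk, Fin.val_mk, adjC_of_le (by omega),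
          show p + d - p = d by omega, show n - (p + d) = q by omega]
      have hmem : (triT n).adjugate ⟨p, hp⟩ ⟨p + d, hpd⟩ ∈ cofSpan n :=
        Submodule.subset_span ⟨(⟨p, hp⟩, ⟨p + d, hpd⟩), rfl⟩
      have heq : (X 1 ^ d * (tco p * tco q) : MvPolynomial (Fin 3) ℂ) =
          ((-1 : ℂ) ^ d) • (triT n).adjugate ⟨p, hp⟩ ⟨p + d, hpd⟩ := by
        have hsq : ((-1 : MvPolynomial (Fin 3) ℂ) ^ d) * (-1) ^ d = 1 := by
          rw [← mul_pow, neg_one_mul, neg_neg, one_pow]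
        rw [hgen, smul_eq_C_mul, map_pow, map_neg, map_one, neg_pow (X 1 : MvPolynomial (Fin 3) ℂ) d,
          show ((-1 : MvPolynomial (Fin 3) ℂ)) ^ d * ((-1) ^ d * X 1 ^ d * tco p * tco q) =
            ((-1) ^ d * (-1) ^ d) * (X 1 ^ d * (tco p * tco q)) by ring, hsq, one_mul]
      rw [heq]
      exact Submodule.smul_mem _ _ hmem
    have heq : (X 0 ^ a * X 1 ^ (c + d) * X 2 ^ c : MvPolynomial (Fin 3) ℂ) =
        X 1 ^ d * (X 0 ^ a * (X 1 * X 2) ^ c) := by ring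
    rw [heq]
    exact hmul
  · obtain ⟨d, rfl⟩ : ∃ d, c = b + d := ⟨c - b, by omega⟩
    have hd : 0 < d := by omega
    have hS := tco_X_pow_mul_w_pow_mem a b
    have hmul : (X 2 ^ d * (X 0 ^ a * (X 1 * X 2) ^ b) : MvPolynomial (Fin 3) ℂ) ∈ cofSpan n := by
      refine mul_mem_span_of_forall_mul_mem hS fun s hs => ?_
      obtain ⟨p, q, hpq, rfl⟩ := hs
      have hp : p < n + 1 := by omega
      have hpd : p + d < n + 1 := by omega
      have hgen : (triT n).adjugate ⟨p + d, hpd⟩ ⟨p, hp⟩ = (-X 2) ^ d * tco p * tco q := by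
        rw [adjugate_triT_apply, Fin.val_mk, Fin.val_mk, adjC_of_lt (by omega),
          show p + d - p = d by omega, show n - (p + d) = q by omega]
      have hmem : (triT n).adjugate ⟨p + d, hpd⟩ ⟨p, hp⟩ ∈ cofSpan n :=
        Submodule.subset_span ⟨(⟨p + d, hpd⟩, ⟨p, hp⟩), rfl⟩
      have heq : (X 2 ^ d * (tco p * tco q) : MvPolynomial (Fin 3) ℂ) =
          ((-1 : ℂ) ^ d) • (triT n).adjugate ⟨p + d, hpd⟩ ⟨p, hp⟩ := by
        have hsq : ((-1 : MvPolynomial (Fin 3) ℂ) ^ d) * (-1) ^ d = 1 := by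
          rw [← mul_pow, neg_one_mul, neg_neg, one_pow]
        rw [hgen, smul_eq_C_mul, map_pow, map_neg, map_one, neg_pow (X 2 : MvPolynomial (Fin 3) ℂ) d,
          show ((-1 : MvPolynomial (Fin 3) ℂ)) ^ d * ((-1) ^ d * X 2 ^ d * tco p * tco q) =
            ((-1) ^ d * (-1) ^ d) * (X 2 ^ d * (tco p * tco q)) by ring, hsq, one_mul]
      rw [heq]
      exact Submodule.smul_mem _ _ hmem
    have heq : (X 0 ^ a * X 1 ^ b * X 2 ^ (b + d) : MvPolynomial (Fin 3) ℂ) =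
        X 2 ^ d * (X 0 ^ a * (X 1 * X 2) ^ b) := by ring
    rw [heq]
    exact hmul

/-! ## The tangent span `span{X_t · adj(T)_{ij}}` is all of degree `n + 1` -/

/-- The `ℂ`-span of the products `X_t · adj(T)_{ij}` — the image of the differential of
`(A₀, A₁, A₂) ↦ det(x A₀ + y A₁ + z A₂)` at the tridiagonal pencil, written on forms. [this crux] -/
def tanSpan (n : ℕ) : Submodule ℂ (MvPolynomial (Fin 3) ℂ) :=
  Submodule.span ℂ (Set.range fun tij : Fin 3 × Fin (n + 1) × Fin (n + 1) =>
    X tij.1 * (triT n).adjugate tij.2.1 tij.2.2)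

/-- `X_t · (cofactor span) ⊆ tangent span`. [this file] -/
theorem X_mul_mem_tanSpan {n : ℕ} (t : Fin 3) {f : MvPolynomial (Fin 3) ℂ} (hf : f ∈ cofSpan n) :
    X t * f ∈ tanSpan n := by
  refine mul_mem_span_of_forall_mul_mem hf fun s hs => ?_
  obtain ⟨⟨i, j⟩, rfl⟩ := hs
  exact Submodule.subset_span ⟨(t, i, j), rfl⟩

/-- Every monomial `x^a y^b z^c` of degree `n + 1` lies in the tangent span. [this crux] -/
theorem monomial_mem_tanSpan {n a b c : ℕ} (h : a + b + c = n + 1) :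
    (X 0 ^ a * X 1 ^ b * X 2 ^ c : MvPolynomial (Fin 3) ℂ) ∈ tanSpan n := by
  rcases a with _ | a
  · rcases b with _ | b
    · obtain ⟨c, rfl⟩ : ∃ c', c = c' + 1 := ⟨c - 1, by omega⟩
      have hm := monomial_mem_cofSpan (n := n) (a := 0) (b := 0) (c := c) (by omega)
      have := X_mul_mem_tanSpan 2 hm
      convert this using 1
      ring
    · have hm := monomial_mem_cofSpan (n := n) (a := 0) (b := b) (c := c) (by omega)
      have := X_mul_mem_tanSpan 1 hm
      convert this using 1
      ring
  · have hm := monomial_mem_cofSpan (n := n) (a := a) (b := b) (c := c) (by omega)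
    have := X_mul_mem_tanSpan 0 hm
    convert this using 1
    ring

/-- A monomial of `ℂ[x, y, z]` as a product of powers. [folklore] -/
theorem monomial_fin_three (e : Fin 3 →₀ ℕ) :
    (monomial e (1 : ℂ) : MvPolynomial (Fin 3) ℂ) = X 0 ^ e 0 * X 1 ^ e 1 * X 2 ^ e 2 := by
  rw [monomial_eq, C_1, one_mul, Finsupp.prod_fintype _ _ (fun _ => pow_zero _), Fin.prod_univ_three]

/-- **Surjectivity of the differential, on forms**: every ternary form of degree `n + 1` lies in
`span_ℂ {X_t · adj(T)_{ij}}`, i.e. the homogeneous component of degree `n + 1` of `ℂ[x, y, z]` is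
contained in the tangent span of the determinant map at the tridiagonal Toeplitz pencil.
[this crux] -/
theorem homogeneousSubmodule_le_tanSpan : ∀ n : ℕ, MvPolynomial.homogeneousSubmodule (Fin 3) ℂ (n + 1) ≤ tanSpan n := by
  intro n f hf
  rw [mem_homogeneousSubmodule] at hf
  rw [f.as_sum]
  refine Submodule.sum_mem _ fun e he => ?_
  have hdeg : e 0 + e 1 + e 2 = n + 1 := by
    have h := hf (mem_support_iff.mp he)
    rw [Finsupp.weight_apply, Finsupp.sum_fintype _ _ (by simp), Fin.sum_univ_three] at h
    simpa using h
  have hmono : (monomial e (coeff e f) : MvPolynomial (Fin 3) ℂ) =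
      coeff e f • (X 0 ^ e 0 * X 1 ^ e 1 * X 2 ^ e 2) := by
    rw [← monomial_fin_three, smul_monomial, smul_eq_mul, mul_one]
  rw [hmono]
  exact Submodule.smul_mem _ _ (monomial_mem_tanSpan hdeg)

end

end Summit.ValiantsHypothesis.ValiantsHypothesis.Theorems.ValuativeFlip
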